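import Summits.AtomisticToContinuum.Crystallization.Theses.ChessboardParticlePlanes
import Summits.AtomisticToContinuum.Crystallization.Theorems.ChessboardParticlePlanesLjPlaneChessboardLayerCosets

/-!
# Crux `ChessboardParticlePlanes.LjPlaneChessboard` (stmt-AtomisticToContinuum-6709), line `Sketch`,
# stub `layerTransversal` — the layer motifs of one vertical period form a transversal

Let `Q` be a periodic configuration of `ℝ³` (periods `G = Q.lattice`, point set `S = Q.points`),
`a, b ∈ G` two horizontal periods generating all horizontal periods over `ℤ`, and `g₀ ∈ G` a
vertical period: every period has height `g 2 ∈ (g₀ 2) ℤ`, the occupied heights are enumerated by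
a strictly increasing `z : ℤ → ℝ` with `z (i + n) = z i + g₀ 2` (`n > 0`), and every layer
`S ∩ {x₂ = z m}` is presented as the disjoint union of the cosets `f + ℤa + ℤb` over a finite set
`F m` of pairwise `ℤa + ℤb`-inequivalent points of `S` of height `z m`.  Then the finite set
`T = ⋃_{i < n} F i` is a transversal of `S` modulo `G`: `T ⊆ S`, its points are pairwise
inequivalent modulo `G`, every point of `S` is congruent modulo `G` to a point of `T`, and (the
union being disjoint) `Σ_{t ∈ T} d t = Σ_{i < n} Σ_{f ∈ F i} d f` for every `d`.  [folklore]

PROOF.  `g₀ 2 > 0` since `z 0 < z n = z 0 + g₀ 2`.  Inequivalence: for `t ∈ F i`, `t' ∈ F i'`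
(`i, i' < n`) with `t − t' ∈ G` the height `z i − z i' = (t − t') 2` is an integer multiple of
`g₀ 2` of absolute value `< g₀ 2` (both heights lie in `[z 0, z 0 + g₀ 2)`), hence zero, so
`i = i'`; then `t − t'` is a horizontal period `k a + l b` and the inequivalence inside `F i`
forces `t = t'`.  Covering: a point `y ∈ S` has height `z m'`; write `m' = m + j n` with
`0 ≤ m < n`; since `z (m + j n) = z m + j (g₀ 2)` the point `y − j g₀ ∈ S` has height `z m`, so
`y − j g₀ = f + k a + l b` with `f ∈ F m ⊆ T` and `y − f = k a + l b + j g₀ ∈ G`.  The sum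
formula is `Finset.sum_biUnion`, the sets `F i` being pairwise disjoint (distinct heights).
No definition is introduced.
-/

noncomputable section

namespace Summit.AtomisticToContinuum.Crystallization.Theorems.ChessboardParticlePlanesLjPlaneChessboard

open Literature.MathematicalPhysics.StatisticalMechanics

/-- Iterating the vertical period relation `z (i + n) = z i + c` an integer number of times:
`z (m + j n) = z m + j c` for all `m j : ℤ`. [folklore] -/
theorem layerTransversal_height_shift {z : ℤ → ℝ} {n : ℕ} {c : ℝ}
    (hper : ∀ i : ℤ, z (i + n) = z i + c) (m j : ℤ) : z (m + j * n) = z m + j * c := by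
  induction j with
  | zero => simp
  | succ i ih =>
    have h1 := hper (m + (i : ℤ) * n)
    rw [show m + ((i : ℤ) + 1) * (n : ℤ) = m + (i : ℤ) * n + n by ring, h1, ih]
    push_cast
    ring
  | pred i ih =>
    have h1 := hper (m + (-(i : ℤ) - 1) * n)
    rw [show m + (-(i : ℤ) - 1) * (n : ℤ) + n = m + -(i : ℤ) * n by ring, ih] at h1
    push_cast at h1 ⊢
    linarith

/-- Heights enumerated by a strictly increasing `z` with period relation `z (i + n) = z i + c`:
two indices `i, i' < n` whose heights differ by an integer multiple of `c` are equal (both heights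
lie in the half-open window `[z 0, z 0 + c)` of length `c`). [folklore] -/
theorem layerTransversal_index_eq {z : ℤ → ℝ} {n : ℕ} {c : ℝ} (hz : StrictMono z)
    (hper : ∀ i : ℤ, z (i + n) = z i + c) {i i' : ℕ} (hi : i < n) (hi' : i' < n) {k : ℤ}
    (hk : z i - z i' = c * k) : i = i' := by
  have hn : z (n : ℤ) = z 0 + c := by simpa using hper 0
  have h0i : z 0 ≤ z i := hz.monotone (by omega)
  have h0i' : z 0 ≤ z i' := hz.monotone (by omega)
  have hin : z i < z 0 + c := hn ▸ hz (by omega)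
  have hi'n : z i' < z 0 + c := hn ▸ hz (by omega)
  have hc : 0 < c := by linarith
  have hk0 : k = 0 := by
    have h1 : (k : ℝ) < 1 := by
      by_contra h
      have := mul_le_mul_of_nonneg_left (not_lt.1 h) hc.le
      linarith
    have h2 : (-1 : ℝ) < k := by
      by_contra h
      have := mul_le_mul_of_nonneg_left (not_lt.1 h) hc.le
      linarith
    have h1' : k < 1 := by exact_mod_cast h1
    have h2' : -1 < k := by exact_mod_cast h2
    omega
  rw [hk0, Int.cast_zero, mul_zero, sub_eq_zero] at hk
  exact_mod_cast hz.injective hk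

/-- **Stub `layerTransversal` — the layer motifs over one vertical period form a transversal.**
For a periodic configuration `Q` of `ℝ³`, horizontal periods `a, b` generating all horizontal
periods over `ℤ`, a vertical period `g₀` (all period heights in `(g₀ 2) ℤ`), occupied heights
`z : ℤ → ℝ` (strictly increasing, `z (i + n) = z i + g₀ 2`, `n > 0`) and layer presentations
`F m` (finite sets of pairwise `ℤa + ℤb`-inequivalent points of height `z m` whose cosets
`f + ℤa + ℤb` exhaust the layer), the union `T = ⋃_{i < n} F i` is a transversal of `Q.points`
modulo `Q.lattice` — contained in `Q.points`, pairwise inequivalent, meeting every class — and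
`Σ_{t ∈ T} d t = Σ_{i < n} Σ_{f ∈ F i} d f` for every `d` (disjoint union). [folklore] -/
theorem layerTransversal :
    ∀ (Q : PeriodicConfiguration 3) (a b g₀ : EuclideanSpace ℝ (Fin 3)) (z : ℤ → ℝ) (n : ℕ)
      (F : ℤ → Finset (EuclideanSpace ℝ (Fin 3))),
      a ∈ Q.lattice → b ∈ Q.lattice → a 2 = 0 → b 2 = 0 →
      (∀ g ∈ Q.lattice, g 2 = 0 → ∃ k l : ℤ, g = (k : ℝ) • a + (l : ℝ) • b) →
      g₀ ∈ Q.lattice → 0 < n → StrictMono z → (∀ i : ℤ, z (i + n) = z i + g₀ 2) →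
      (∀ g ∈ Q.lattice, ∃ k : ℤ, g 2 = g₀ 2 * k) →
      (∀ y ∈ Q.points, ∃ i : ℤ, y 2 = z i) →
      (∀ m : ℤ, ∀ f ∈ F m, f 2 = z m ∧ f ∈ Q.points) →
      (∀ m : ℤ, ∀ f ∈ F m, ∀ f' ∈ F m, f ≠ f' → ∀ k l : ℤ, f' ≠ f + (k : ℝ) • a + (l : ℝ) • b) →
      (∀ (m : ℤ) (y : EuclideanSpace ℝ (Fin 3)),
        (y ∈ Q.points ∧ y 2 = z m) ↔ ∃ f ∈ F m, ∃ k l : ℤ, y = f + (k : ℝ) • a + (l : ℝ) • b) →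
      (∀ m : ℤ, F (m + n) = (F m).image (fun f => f + g₀)) →
      (∀ t ∈ (Finset.range n).biUnion (fun i : ℕ => F i), t ∈ Q.points) ∧
      (∀ t ∈ (Finset.range n).biUnion (fun i : ℕ => F i),
        ∀ t' ∈ (Finset.range n).biUnion (fun i : ℕ => F i), t - t' ∈ Q.lattice → t = t') ∧
      (∀ y ∈ Q.points, ∃ t ∈ (Finset.range n).biUnion (fun i : ℕ => F i), y - t ∈ Q.lattice) ∧
      (∀ d : EuclideanSpace ℝ (Fin 3) → ℝ,
        ∑ t ∈ (Finset.range n).biUnion (fun i : ℕ => F i), d t = ∑ i ∈ Finset.range n, ∑ f ∈ F i, d f) := by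
  intro Q a b g₀ z n F ha hb _ _ hgen hg₀ hn hz hzper hvert hheights hF hFinj hFiff _
  refine ⟨?_, ?_, ?_, ?_⟩
  · -- (1) `T ⊆ Q.points`
    intro t ht
    obtain ⟨i, -, hti⟩ := Finset.mem_biUnion.1 ht
    exact (hF i t hti).2
  · -- (2) the points of `T` are pairwise inequivalent modulo `G`
    intro t ht t' ht' hsub
    obtain ⟨i, hi, hti⟩ := Finset.mem_biUnion.1 ht
    obtain ⟨i', hi', hti'⟩ := Finset.mem_biUnion.1 ht'
    rw [Finset.mem_range] at hi hi'
    obtain ⟨ht2, -⟩ := hF i t hti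
    obtain ⟨ht'2, -⟩ := hF i' t' hti'
    obtain ⟨k, hk⟩ := hvert _ hsub
    rw [PiLp.sub_apply, ht2, ht'2] at hk
    obtain rfl := layerTransversal_index_eq hz hzper hi hi' hk
    -- same layer: `t - t'` is a horizontal period, hence in `ℤa + ℤb`
    have h0 : (t - t') 2 = 0 := by rw [PiLp.sub_apply, ht2, ht'2, sub_self]
    obtain ⟨k, l, hkl⟩ := hgen _ hsub h0
    by_contra hne
    exact hFinj i t' hti' t hti (Ne.symm hne) k l (by rw [add_assoc, ← hkl]; abel)
  · -- (3) every point of `Q` is congruent modulo `G` to a point of `T`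
    intro y hy
    obtain ⟨m', hm'⟩ := hheights y hy
    have hn0 : (0 : ℤ) < n := by exact_mod_cast hn
    obtain ⟨m, j, hm0, hmn, rfl⟩ : ∃ m j : ℤ, 0 ≤ m ∧ m < n ∧ m' = m + j * n :=
      ⟨m' % n, m' / n, Int.emod_nonneg _ hn0.ne', Int.emod_lt_of_pos _ hn0,
        (Int.emod_add_ediv_mul m' n).symm⟩
    -- shift `y` down by `j` vertical periods to the layer of height `z m`
    have hjg : (j : ℝ) • g₀ ∈ Q.lattice := by
      rw [Int.cast_smul_eq_zsmul]
      exact Q.lattice.smul_mem j hg₀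
    have hy'p : y - (j : ℝ) • g₀ ∈ Q.points := by
      rw [sub_eq_add_neg]
      exact Q.add_mem_points hy (Q.lattice.neg_mem hjg)
    have hy'2 : (y - (j : ℝ) • g₀) 2 = z m := by
      rw [PiLp.sub_apply, PiLp.smul_apply, hm', layerTransversal_height_shift hzper, smul_eq_mul]
      ring
    obtain ⟨f, hf, k, l, hkl⟩ := (hFiff m _).1 ⟨hy'p, hy'2⟩
    have hmto : ((m.toNat : ℕ) : ℤ) = m := Int.toNat_of_nonneg hm0
    refine ⟨f, Finset.mem_biUnion.2 ⟨m.toNat, Finset.mem_range.2 (by omega), ?_⟩, ?_⟩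
    · show f ∈ F ((m.toNat : ℕ) : ℤ)
      rw [hmto]
      exact hf
    · rw [sub_eq_iff_eq_add] at hkl
      rw [hkl, show f + (k : ℝ) • a + (l : ℝ) • b + (j : ℝ) • g₀ - f
          = (k : ℝ) • a + (l : ℝ) • b + (j : ℝ) • g₀ by abel]
      exact Q.lattice.add_mem (layerCosets_comb_mem ha hb k l) hjg
  · -- (4) the union `⋃_{i < n} F i` is disjoint (distinct layers have distinct heights)
    intro d
    refine Finset.sum_biUnion ?_
    intro i _ i' _ hne
    show Disjoint (F i) (F i')
    refine Finset.disjoint_left.2 fun f hf hf' => hne ?_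
    have h := ((hF i f hf).1).symm.trans (hF i' f hf').1
    exact_mod_cast hz.injective h

end Summit.AtomisticToContinuum.Crystallization.Theorems.ChessboardParticlePlanesLjPlaneChessboard

end
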